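import Mathlib.Algebra.BigOperators.Fin
import Mathlib.Algebra.BigOperators.Field
import Mathlib.Algebra.Order.BigOperators.Group.Finset
import Mathlib.Data.Real.Basic
import Mathlib.GroupTheory.Perm.Fin
import Mathlib.Order.Interval.Finset.Fin
import Mathlib.Tactic.FieldSimp
import Mathlib.Tactic.Linarith
import Mathlib.Tactic.Ring
import HarnessLib

/-!
# Polymath 8b, §4.5: the partial-fraction identity Lemma 4.4

Trunk AntSieve, companion to `PolymathGEH.lean` (the named fact
`Literature.NumberTheory.Sieve.weakDHL_three_two_of_GEH`, D. H. J. Polymath, *Variants of the Selberg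
sieve, and bounded intervals containing many primes*, Res. Math. Sci. 1:12 (2014) = arXiv:1407.4897,
Theorem 3.2(xii): `GEH ⟹ DHL[3,2]`).  The printed proof of Theorem 3.2(xii) runs through Theorem 3.14,
whose non-prime sums are evaluated by Theorem 3.6(ii) (the generalized Elliott–Halberstam case of the
sieve asymptotics, §4.5); the main-term computation of §4.5 rests on the identity (depol), which in turn
is driven by the elementary **Lemma 4.4** (p. 18 of the arXiv version):

  for positive reals `t₁, …, t_r`, `1/(t₁ ⋯ t_r) = Σ_{σ ∈ S_r} 1/∏_{i=1}^r (Σ_{j=i}^r t_{σ(j)})`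

("thus, for instance, when `r = 2` we have `1/(t₁t₂) = 1/((t₁+t₂)t₁) + 1/((t₁+t₂)t₂)`").  This file
PROVES it (`inv_prod_eq_sum_perm_inv_prod_tailSum`), by the printed induction: both sides obey
`f_r(t) = (t₁ + ⋯ + t_r)⁻¹ Σᵢ f_{r-1}(t with tᵢ removed)`; formally we split off the factor `i = 1`
(which is `Σⱼ t_j` for every `σ`) and decompose `σ` by its first value (`Equiv.Perm.decomposeFin`).

## Rendering

Indices are `Fin r` (so `i = 1, …, r` becomes `i : Fin r` and `Σ_{j=i}^r` becomes `Σ_{j ∈ Ici i}`); the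
statement is proved for every `r : ℕ` (for `r = 0` both sides are `1`, an empty product resp. the single
empty permutation).

## References

* [Polymath8b2014] D. H. J. Polymath, Res. Math. Sci. 1 (2014), Art. 12 = arXiv:1407.4897, Lemma 4.4
  (identity (star)), p. 18.
-/

open Finset
open scoped BigOperators

namespace Literature.NumberTheory.Sieve

/-- The tail sums `Σ_{j ≥ i} t_{σ(j)}` appearing in Polymath 8b Lemma 4.4, written as a filtered sum over
all of `Fin r` (the form in which the induction manipulates them). [cite: Polymath8b2014, Lemma 4.4] -/
theorem sum_Ici_eq_sum_ite {r : ℕ} (i : Fin r) (f : Fin r → ℝ) :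
    ∑ j ∈ Ici i, f j = ∑ j, if i ≤ j then f j else 0 := by
  rw [← Finset.sum_filter]
  congr 1
  ext j
  simp

/-- The first tail sum is the full sum: `Σ_{j ≥ 0} t_{σ(j)} = Σ_j t_j` for every permutation `σ`
(Polymath 8b, proof of Lemma 4.4: the common factor `1/(t₁ + ⋯ + t_r)`). [cite: Polymath8b2014, Lemma 4.4 (proof)] -/
theorem sum_Ici_zero_perm {n : ℕ} (σ : Equiv.Perm (Fin (n + 1))) (t : Fin (n + 1) → ℝ) :
    ∑ j ∈ Ici (0 : Fin (n + 1)), t (σ j) = ∑ j, t j := by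
  rw [sum_Ici_eq_sum_ite]
  simp only [Fin.zero_le, if_true]
  exact Equiv.sum_comp σ t

/-- The tail sums of `σ = decomposeFin.symm (p, e)` beyond the first index are the tail sums of the
permutation `e` of the reduced tuple `u_k := t (swap 0 p (k+1))` (Polymath 8b, proof of Lemma 4.4: the
recursion `f_r = (Σ t)⁻¹ Σᵢ f_{r-1}(t₁,…,t̂ᵢ,…,t_r)`). [cite: Polymath8b2014, Lemma 4.4 (proof)] -/
theorem sum_Ici_succ_decomposeFin {n : ℕ} (p : Fin (n + 1)) (e : Equiv.Perm (Fin n))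
    (t : Fin (n + 1) → ℝ) (i : Fin n) :
    ∑ j ∈ Ici i.succ, t (Equiv.Perm.decomposeFin.symm (p, e) j) =
      ∑ j ∈ Ici i, t (Equiv.swap 0 p (e j).succ) := by
  rw [sum_Ici_eq_sum_ite, sum_Ici_eq_sum_ite, Fin.sum_univ_succ]
  have h0 : ¬ (i.succ ≤ (0 : Fin (n + 1))) := by
    rw [not_le]
    exact Fin.succ_pos i
  rw [if_neg h0, zero_add]
  refine Finset.sum_congr rfl fun j _ => ?_
  simp only [Fin.succ_le_succ_iff, Equiv.Perm.decomposeFin_symm_apply_succ]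

/-- Removing one entry: `t_p · ∏_k t(swap 0 p (k+1)) = ∏_m t_m` (the reduced tuple of
`sum_Ici_succ_decomposeFin` runs over all indices except `p`). [folklore] -/
theorem mul_prod_swap_succ {n : ℕ} (p : Fin (n + 1)) (t : Fin (n + 1) → ℝ) :
    t p * ∏ k : Fin n, t (Equiv.swap 0 p k.succ) = ∏ m, t m := by
  rw [← Equiv.prod_comp (Equiv.swap (0 : Fin (n + 1)) p) t, Fin.prod_univ_succ,
    Equiv.swap_apply_left]

/-- **Polymath 8b, Lemma 4.4** (identity (star), p. 18): for any positive reals `t₁, …, t_r` with `r ≥ 1`,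
`1/(t₁ ⋯ t_r) = Σ_{σ ∈ S_r} 1/∏_{i=1}^r (Σ_{j=i}^r t_{σ(j)})`; e.g. for `r = 2`,
`1/(t₁t₂) = 1/((t₁+t₂)t₁) + 1/((t₁+t₂)t₂)`.  Indices are rendered by `Fin r` (the case `r = 0` reads
`1 = 1` and is included).  Proof as printed: induction on `r`, both sides satisfying
`f_r(t) = (t₁+⋯+t_r)⁻¹ Σᵢ f_{r-1}(t₁,…,t̂ᵢ,…,t_r)`. [cite: Polymath8b2014, Lemma 4.4] -/
theorem inv_prod_eq_sum_perm_inv_prod_tailSum :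
    ∀ (r : ℕ) (t : Fin r → ℝ), (∀ i, 0 < t i) →
      (∏ i, t i)⁻¹ = ∑ σ : Equiv.Perm (Fin r), (∏ i, ∑ j ∈ Ici i, t (σ j))⁻¹
  | 0, t, _ => by simp
  | n + 1, t, ht => by
    -- the common first factor `T = Σ t`
    have hTpos : 0 < ∑ j, t j := Finset.sum_pos (fun i _ => ht i) Finset.univ_nonempty
    have hPpos : 0 < ∏ i, t i := Finset.prod_pos fun i _ => ht i
    -- decompose `σ` by its first value
    rw [← Equiv.sum_comp Equiv.Perm.decomposeFin.symm, Fintype.sum_prod_type]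
    have key : ∀ (p : Fin (n + 1)) (e : Equiv.Perm (Fin n)),
        ∏ i, ∑ j ∈ Ici i, t (Equiv.Perm.decomposeFin.symm (p, e) j) =
          (∑ j, t j) * ∏ i : Fin n, ∑ j ∈ Ici i, t (Equiv.swap 0 p (e j).succ) := by
      intro p e
      rw [Fin.prod_univ_succ, sum_Ici_zero_perm]
      simp only [sum_Ici_succ_decomposeFin]
    simp only [key, mul_inv, ← Finset.mul_sum]
    -- the induction hypothesis for each reduced tuple
    have ih : ∀ p : Fin (n + 1),
        ∑ e : Equiv.Perm (Fin n), (∏ i : Fin n, ∑ j ∈ Ici i, t (Equiv.swap 0 p (e j).succ))⁻¹ =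
          (∏ k : Fin n, t (Equiv.swap 0 p k.succ))⁻¹ := fun p =>
      (inv_prod_eq_sum_perm_inv_prod_tailSum n (fun k => t (Equiv.swap 0 p k.succ))
        fun k => ht _).symm
    simp only [ih]
    -- `Σ_p T⁻¹ (∏_{k ≠ p} t_k)⁻¹ = T⁻¹ Σ_p t_p / ∏ t = (∏ t)⁻¹`
    have hred : ∀ p : Fin (n + 1), (∏ k : Fin n, t (Equiv.swap 0 p k.succ))⁻¹ = t p / ∏ m, t m := by
      intro p
      have hu : (∏ k : Fin n, t (Equiv.swap 0 p k.succ)) ≠ 0 :=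
        (Finset.prod_pos fun k _ => ht _).ne'
      rw [← mul_prod_swap_succ p t, eq_div_iff (mul_ne_zero (ht p).ne' hu)]
      field_simp
    simp only [hred, ← Finset.sum_div]
    rw [← mul_div_assoc, inv_mul_cancel₀ hTpos.ne', one_div]

/-- The case `r = 2` displayed in Polymath 8b after Lemma 4.4:
`1/(t₁ t₂) = 1/((t₁+t₂)t₁) + 1/((t₁+t₂)t₂)`. [cite: Polymath8b2014, Lemma 4.4] -/
theorem inv_mul_eq_of_pos {t₁ t₂ : ℝ} (h₁ : 0 < t₁) (h₂ : 0 < t₂) :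
    (t₁ * t₂)⁻¹ = ((t₁ + t₂) * t₁)⁻¹ + ((t₁ + t₂) * t₂)⁻¹ := by
  have h12 : 0 < t₁ + t₂ := by linarith
  field_simp
  ring

end Literature.NumberTheory.Sieve
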